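import Summits.ResolutionOfSingularities.ResolutionOfSingularities.Theorems.CleanCoversCoverResolutionKedlayaLocalCover
import Literature.AlgebraicGeometry.Resolution.KedlayaEtaleCoversProofs
import Literature.AlgebraicGeometry.Resolution.ResolutionProjectiveReduction
import Literature.AlgebraicGeometry.Resolution.PrincipalizationToResolution
import HarnessLib

/-!
# Crux `CleanCovers.CoverResolution` (stmt-ResolutionOfSingularities-15104), line `strategy-split`
# (v2.1): CERTIFICATE `locallyResolvable_perfect_of_boundaryLocalResolution`

Route `ResolutionOfSingularities/CleanCovers`. A *Kedlaya cover* is an integral scheme `X` with a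
finite surjective `f : X → ℙⁿ_k` (`k` perfect of characteristic `p`) which is étale over the chart
`A := D₊(xₙ)`. The line's open stub **L** asks: around every point `h ∉ A` of `ℙⁿ_k` there is an
open `B ∋ h` with `f⁻¹(B)` resolvable (`Scheme.HasResolution`). This file CALIBRATES L against the
sibling route `UniversalCells` (crux `LocalToGlobal`: pointwise local resolvability ⇒ resolution):
it PROVES that L implies **LOCRES** — every point of every integral separated scheme of finite
type over a perfect field of positive characteristic has a resolvable open neighbourhood.

Proof. Given `g : X → Spec k` and `x ∈ X`: (1) pick an affine open `V ∋ x`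
(`exists_isAffineOpen_mem_and_subset`); `V` is integral (`isIntegral_of_isOpenImmersion`) and of
finite type over `k` through `V ↪ X → Spec k`. (2) Embed `ρ : V ↪ ℙᵐ_k`
(`ChowLemmaProof.exists_immersion_projectiveSpace`, Görtz–Wedhorn §(12.15)) and take the
projective closure `V ↪ X̄ ↪ ℙᵐ_k` (`exists_projectiveClosure`: `j : V → X̄` an open immersion,
`c : X̄ → ℙᵐ_k` a closed immersion, `X̄` integral). (3) Kedlaya's theorem in the tree's proved form
(`Kedlaya2004_finite_etale_off_hyperplane_holds`, Kedlaya 2005 Thm. 1; a closed immersion is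
finite) makes `X̄` a Kedlaya cover `f : X̄ → ℙⁿ_k`. (4) By L and the landed stub A4
(`stub_kedlayaLocalCover`: over the chart `f⁻¹(A)` is étale over a regular scheme, hence regular,
hence its own resolution; off the chart L applies) every point of `X̄` has a resolvable open
neighbourhood; take one, `W ∋ j(x)`. (5) Pull back along the open immersion `j ∣_ W`
(`Scheme.HasResolution.of_isOpenImmersion`) to `j⁻¹(W) ∋ x`, an open of `V`, and push it into `X`
along `V.ι` (`Scheme.Hom.isoImage`, `Scheme.HasResolution.of_iso`). No named fact is taken as a
hypothesis.
-/

set_option linter.dupNamespace false -- mandated namespace of this single-conjunct summit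

noncomputable section

namespace Summit.ResolutionOfSingularities.ResolutionOfSingularities.Theorems

open CategoryTheory AlgebraicGeometry TopologicalSpace
open Literature.AlgebraicGeometry.Resolution

/-- **Certificate `locallyResolvable_perfect_of_boundaryLocalResolution`** (line `strategy-split`
v2.1 of `CoverResolution`): if every Kedlaya cover `f : X → ℙⁿ_k` (`X` integral, `f` finite
surjective, étale over `D₊(xₙ)`; `k` perfect of characteristic `p`) is resolvable locally along the
hyperplane at infinity (stub L), then every point of every integral separated scheme of finite type
over a perfect field of positive characteristic has a resolvable open neighbourhood. Proof: an
affine open neighbourhood `V ∋ x` embeds into some `ℙᵐ_k` (Görtz–Wedhorn §(12.15)); its projective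
closure `X̄` is a Kedlaya cover of some `ℙⁿ_k` (Kedlaya 2005, Thm. 1, proved in the tree as
`Kedlaya2004_finite_etale_off_hyperplane_holds`); by L and `stub_kedlayaLocalCover` the point
`x ∈ V ⊆ X̄` has a resolvable open neighbourhood `W` in `X̄`, and `V.ι(j⁻¹ W)` is the sought open
of `X` (resolutions transport along open immersions and isomorphisms).
[cite: Kedlaya2004, Thm. 1] -/
theorem locallyResolvable_perfect_of_boundaryLocalResolution : (∀ p : ℕ, p.Prime → ∀ (k : Type) [Field k] [CharP k p] [PerfectField k] (n : ℕ) (X : AlgebraicGeometry.Scheme.{0}) (f : X ⟶ (Literature.AlgebraicGeometry.Motives.projectiveSpace n k).left), AlgebraicGeometry.IsIntegral X → AlgebraicGeometry.IsFinite f → Function.Surjective f.base → (letI := MvPolynomial.gradedAlgebra (σ := Fin (n + 1)) (R := k); AlgebraicGeometry.Etale (f ∣_ (AlgebraicGeometry.Proj.basicOpen (MvPolynomial.homogeneousSubmodule (Fin (n + 1)) k) (MvPolynomial.X (Fin.last n))))) → ∀ h : (Literature.AlgebraicGeometry.Motives.projectiveSpace n k).left, (letI := MvPolynomial.gradedAlgebra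 (σ := Fin (n + 1)) (R := k); h ∉ AlgebraicGeometry.Proj.basicOpen (MvPolynomial.homogeneousSubmodule (Fin (n + 1)) k) (MvPolynomial.X (Fin.last n))) → ∃ B : (Literature.AlgebraicGeometry.Motives.projectiveSpace n k).left.Opens, h ∈ B ∧ Literature.AlgebraicGeometry.Resolution.Scheme.HasResolution ((f ⁻¹ᵁ B : X.Opens) : AlgebraicGeometry.Scheme.{0})) → (∀ p : ℕ, p.Prime → ∀ (k : Type) [Field k] [CharP k p] [PerfectField k] (X : AlgebraicGeometry.Scheme.{0}) (g : X ⟶ AlgebraicGeometry.Spec (.of k)), AlgebraicGeometry.IsSeparated g → AlgebraicGeometry.LocallyOfFiniteType g → AlgebraicGeometry.QuasiCompact g → AlgebraicGeometry.IsIntegral X → ∀ x : X, ∃ U : X.Opens, x ∈ U ∧ Literature.AlgebraicGeometry.Resolution.Scheme.HasResolution (U : AlgebraicGeometry.Scheme.{0})) := by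
  intro hL p hp k _ _ _ X g _ hl _ hi x
  -- (1) an affine open neighbourhood `V ∋ x`; it is integral and of finite type over `k`
  obtain ⟨V, hV, hxV, -⟩ := exists_isAffineOpen_mem_and_subset (U := ⊤) (Opens.mem_top x)
  haveI : IsAffine (V : Scheme.{0}) := hV
  haveI : Nonempty (V : Scheme.{0}) := ⟨(⟨x, hxV⟩ : V)⟩
  haveI : IsIntegral (V : Scheme.{0}) := isIntegral_of_isOpenImmersion V.ι
  -- (2) an immersion `ρ : V ↪ ℙᵐ_k` and the projective closure `V ↪ Xbar ↪ ℙᵐ_k`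
  obtain ⟨m, ρ, hρ, -⟩ := ChowLemmaProof.exists_immersion_projectiveSpace k (V.ι ≫ g)
  haveI := hρ
  obtain ⟨Xbar, j, c, hXbar, hj, hc, -, -⟩ := exists_projectiveClosure ρ
  haveI := hXbar
  haveI := hj
  haveI := hc
  -- (3) Kedlaya: a finite surjective `f : Xbar → ℙⁿ_k`, étale over the chart `D₊(xₙ)`
  obtain ⟨n, f, -, hfin, hsurj, het⟩ :=
    Kedlaya2004_finite_etale_off_hyperplane_holds p hp k m Xbar c hXbar inferInstance
  -- (4) every point of `Xbar` has a resolvable open neighbourhood (stub A4 and L)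
  obtain ⟨W, hxW, hW⟩ := stub_kedlayaLocalCover k n Xbar f het
    (hL p hp k n Xbar f hXbar hfin hsurj het) (j.base ⟨x, hxV⟩)
  -- (5) pull back along the open immersion `j ∣_ W : j ⁻¹ W → W`
  have hW' : Scheme.HasResolution ((j ⁻¹ᵁ W : (V : Scheme.{0}).Opens) : Scheme.{0}) :=
    hW.of_isOpenImmersion (j ∣_ W)
  -- (6) push the open `j ⁻¹ W ∋ x` of `V` into `X` along `V.ι`
  exact ⟨V.ι ''ᵁ (j ⁻¹ᵁ W), ⟨⟨x, hxV⟩, hxW, rfl⟩,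
    Scheme.HasResolution.of_iso (V.ι.isoImage (j ⁻¹ᵁ W)).hom hW'⟩

end Summit.ResolutionOfSingularities.ResolutionOfSingularities.Theorems

end
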